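import Summits.CriticalPhenomena.PercolationContinuityZ3.Theorems.PercNearOneGluingNoHeavyConstsClusterSquareUnlinked
import HarnessLib

/-!
# CSQ, DUU and TS on every weighted OUTERPLANAR graph (non-crossing support w.r.t. the cyclic order of `Fin n`), all placements

builds on p205010 (kernel theorem, internal audit signed; external expert review pending)

PAPER-2 track "percolation constants", part (ii), seat `prim-consts-1`, gen 19 (lane index
`run/shared/lean/prim/consts/CONSTANTS.md`, row A19; memo `FROM-prim-consts-1-g19-ROOT-CHOICE.md` §3).
Support file for the crux `NoHeavyLowerTail` (stmt-CriticalPhenomena-4575; `--supports`).  Theorems only (the cut-open position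
`(u - a).val` and the gap count are written inline); no definitions, no sorries.

THE RESULT.  Let the support graph `H ⊇ {positive pairs}` on `Fin n` be NON-CROSSING for the standard cyclic order
`0, 1, …, n − 1` (no two edges `{p, q}`, `{r, s}` with `p < r < q < s`), i.e. `H` is outerplanar with all vertices on the outer cycle in
this order.  Then for EVERY three vertices `a, b, c` no cluster of `a` is doubly linked to `{b, c}` (`Consts.NonCrossing.unlinked`), so by
gen 17's `Consts.clusterSquare_le_sq_of_unlinked` the cluster-square inequality CSQ `T ≤ U²`, the rooted split inequality DUU and the
triple-split inequality TS `μ(a|b|c)² ≤ μ(a↮b) μ(a↮c) μ(b↮c)` hold for every weight vector supported on `H` and every placement of the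
terminals (`Consts.clusterSquare_le_sq_of_nonCrossing`, `Consts.sq_real_split_le_of_nonCrossing`, `Consts.tripleSplit_of_nonCrossing`).
This is the first TOPOLOGICAL class in the lane's TS/CSQ list (after `n ≤ 4`, degree conditions, `K₂,ₘ` and the decidable linkage
criteria); it contains all cycles, fans, cacti and triangulated polygons, with arbitrary terminals.  It is the outerplanar case of the
lane's paper-level claim "planar with `a, b, c` on a common face ⇒ no double clash" (memo g17 §0(6)); the general planar case needs faces
and is not formalised.

THE PROOF (a discrete Jordan-curve argument on the cycle).  Cut the cycle open at `a`: the position of `u` is `(u - a).val = (u − a) mod n`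
(`Fin` subtraction).  For a vertex set `S ∋ a` that is `H`-connected from `a` and a vertex `u ∉ S` let `(Finset.univ.filter (fun s => s ∈ S ∧ (s - a).val < (u - a).val)).card` be the number of
vertices of `S` met on the way from `a` to `u`;
two vertices outside `S` lie in the same gap of `S` iff their counts agree.  KEY LEMMA (`cnt_eq_of_adj`): adjacent vertices outside `S`
have equal counts — otherwise some `s ∈ S` lies strictly between them and `a ∈ S` does not, and an `S`-walk from `s` to `a` has an edge
crossing the edge between them.  Hence a walk avoiding `S` stays in one gap (`cnt_eq_of_walk`).  Now suppose both linkages of a double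
clash exist: walks `P₁ : y → b`, `P₂ : y' → c` avoiding `K` with disjoint supports and `Q₁ : y → c`, `Q₂ : y' → b` likewise.  Applied to
`S = K ∪ {y}` (walks `P₂`, `Q₂`) and `S = K ∪ {y'}` (walks `P₁`, `Q₁`) the lemma shows that neither `y` nor `y'` lies strictly between two
of the other three points, so `y, y'` are the extreme points of `{y, y', b, c}` in the cut-open order; then one of the two linkages is
interleaved, and the lemma applied to `S = K ∪ supp(W)` for the appropriate walk `W` of the OTHER linkage gives the contradiction.
References: N. Gladkov, arXiv:2408.08457v2 (2024), Thm. 4.3, Def. 4.2, Lemma 3.1, Thm. 5.2 (the two-copy vdBK behind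
`…ClusterSquareUnlinked`); G. Chartrand, F. Harary, Ann. Inst. H. Poincaré B 3 (1967) 433–438 (outerplanar graphs).
-/

noncomputable section

open Classical

namespace Summit.CriticalPhenomena.PercolationContinuityZ3.Theorems

open MeasureTheory Finset Literature.Probability.LatticeModels Literature.Probability.Percolation

namespace Consts

namespace NonCrossing

variable {n : ℕ}

/-! ### The cycle cut open at a base vertex -/

/-- Position of `u` on the cycle `0, 1, …, n-1` cut open at `o`: `(u - o).val = (u - o) mod n` (`Fin` subtraction), as a case split.
[folklore] -/
theorem val_sub_eq (o u : Fin n) : (u - o).val = if (o : ℕ) ≤ u then (u : ℕ) - o else (u : ℕ) + n - o := by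
  have hu := u.isLt
  split_ifs with h
  · exact Fin.coe_sub_iff_le.2 (Fin.le_def.2 h)
  · rw [Fin.coe_sub_iff_lt.2 (Fin.lt_def.2 (by omega))]; omega

/-- The cut-open position is injective. [folklore] -/
theorem rot_injective (o : Fin n) {u v : Fin n} (h : (u - o).val = (v - o).val) : u = v := by
  have hu := u.isLt; have hv := v.isLt
  apply Fin.ext
  rw [val_sub_eq, val_sub_eq] at h
  split_ifs at h <;> omega

/-- The base vertex has position `0`. [folklore] -/
theorem rot_self (o : Fin n) : (o - o).val = 0 := by
  rw [val_sub_eq]; simp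

/-- Two crossing chords in the cut-open order are two crossing chords in the original cyclic order (crossing is rotation
invariant): a non-crossing `H` has no edges `{p,q}`, `{r,s}` with `rot p < rot r < rot q < rot s`. [folklore] -/
theorem noncross_rot {H : SimpleGraph (Fin n)}
    (hnc : ∀ p q r s : Fin n, H.Adj p q → H.Adj r s → p < r → r < q → q < s → False) (o : Fin n)
    {p q r s : Fin n} (hpq : H.Adj p q) (hrs : H.Adj r s)
    (h1 : (p - o).val < (r - o).val) (h2 : (r - o).val < (q - o).val) (h3 : (q - o).val < (s - o).val) : False := by
  have hp := p.isLt; have hq := q.isLt; have hr := r.isLt; have hs := s.isLt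
  simp only [val_sub_eq] at h1 h2 h3
  have key : ((p : ℕ) < r ∧ (r : ℕ) < q ∧ (q : ℕ) < s) ∨ ((r : ℕ) < q ∧ (q : ℕ) < s ∧ (s : ℕ) < p) ∨
      ((q : ℕ) < s ∧ (s : ℕ) < p ∧ (p : ℕ) < r) ∨ ((s : ℕ) < p ∧ (p : ℕ) < r ∧ (r : ℕ) < q) := by
    split_ifs at h1 h2 h3 <;> omega
  rcases key with ⟨a1, a2, a3⟩ | ⟨a1, a2, a3⟩ | ⟨a1, a2, a3⟩ | ⟨a1, a2, a3⟩
  · exact hnc p q r s hpq hrs a1 a2 a3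
  · exact hnc r s q p hrs hpq.symm a1 a2 a3
  · exact hnc q p s r hpq.symm hrs.symm a1 a2 a3
  · exact hnc s r p q hrs.symm hpq a1 a2 a3

/-! ### Gaps of a connected set: the counting function -/

/- The GAP COUNT of `u ∉ S` is `#{s ∈ S | (s - o).val < (u - o).val}`, written out in full below (no definition): for `o ∈ S`, two
vertices outside `S` have the same count iff they lie in the same gap of `S` on the cycle. -/

/-- `cnt` is monotone in the position. [folklore] -/
theorem cnt_mono (o : Fin n) (S : Set (Fin n)) {u v : Fin n} (h : (u - o).val ≤ (v - o).val) :
    (Finset.univ.filter (fun s => s ∈ S ∧ (s - o).val < (u - o).val)).card ≤ (Finset.univ.filter (fun s => s ∈ S ∧ (s - o).val < (v - o).val)).card := by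
  refine card_le_card fun s hs => ?_
  rw [mem_filter] at hs ⊢
  exact ⟨hs.1, hs.2.1, lt_of_lt_of_le hs.2.2 h⟩

/-- Equal counts ⇒ no vertex of `S` strictly in between. [folklore] -/
theorem not_between_of_cnt_eq (o : Fin n) (S : Set (Fin n)) {u v s : Fin n}
    (h : (Finset.univ.filter (fun s => s ∈ S ∧ (s - o).val < (u - o).val)).card = (Finset.univ.filter (fun s => s ∈ S ∧ (s - o).val < (v - o).val)).card) (hs : s ∈ S) (h1 : (u - o).val < (s - o).val) (h2 : (s - o).val < (v - o).val) : False := by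
  have hlt : (Finset.univ.filter (fun s => s ∈ S ∧ (s - o).val < (u - o).val)).card < (Finset.univ.filter (fun s => s ∈ S ∧ (s - o).val < (v - o).val)).card := by
    refine card_lt_card ((ssubset_iff_of_subset fun t ht => ?_).2 ⟨s, ?_, ?_⟩)
    · rw [mem_filter] at ht ⊢
      exact ⟨ht.1, ht.2.1, lt_trans ht.2.2 (lt_trans h1 h2)⟩
    · rw [mem_filter]; exact ⟨mem_univ _, hs, h2⟩
    · rw [mem_filter]; exact fun h' => lt_asymm h1 h'.2.2
  omega

/-- Symmetric form of `not_between_of_cnt_eq`. [folklore] -/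
theorem not_between_of_cnt_eq' (o : Fin n) (S : Set (Fin n)) {u v s : Fin n}
    (h : (Finset.univ.filter (fun s => s ∈ S ∧ (s - o).val < (u - o).val)).card = (Finset.univ.filter (fun s => s ∈ S ∧ (s - o).val < (v - o).val)).card) (hs : s ∈ S) :
    ¬ ((u - o).val < (s - o).val ∧ (s - o).val < (v - o).val) ∧ ¬ ((v - o).val < (s - o).val ∧ (s - o).val < (u - o).val) :=
  ⟨fun h' => not_between_of_cnt_eq o S h hs h'.1 h'.2, fun h' => not_between_of_cnt_eq o S h.symm hs h'.1 h'.2⟩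

/-- KEY LEMMA (ordered form): for `S ∋ o` connected from `o` inside `H[S]` and a non-crossing `H`, adjacent vertices outside `S`
have the same count. [folklore: discrete Jordan curve theorem on a cycle] -/
private theorem cnt_eq_of_adj_lt {H : SimpleGraph (Fin n)} {o : Fin n}
    (hnc : ∀ p q r s : Fin n, H.Adj p q → H.Adj r s → (p - o).val < (r - o).val → (r - o).val < (q - o).val → (q - o).val < (s - o).val → False)
    {S : Set (Fin n)} (hS : ∀ s ∈ S, ∃ W : H.Walk o s, ∀ v ∈ W.support, v ∈ S)
    {x x' : Fin n} (hx : x ∉ S) (hx' : x' ∉ S) (hadj : H.Adj x x') (hlt : (x - o).val < (x' - o).val) :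
    (Finset.univ.filter (fun s => s ∈ S ∧ (s - o).val < (x - o).val)).card = (Finset.univ.filter (fun s => s ∈ S ∧ (s - o).val < (x' - o).val)).card := by
  by_contra hne
  -- some vertex of `S` lies strictly between `x` and `x'`
  obtain ⟨k₁, hk₁S, hk₁a, hk₁b⟩ : ∃ k₁ ∈ S, (x - o).val < (k₁ - o).val ∧ (k₁ - o).val < (x' - o).val := by
    by_contra hno
    push Not at hno
    have hsub : Finset.univ.filter (fun s => s ∈ S ∧ (s - o).val < (x' - o).val) ⊆
        Finset.univ.filter (fun s => s ∈ S ∧ (s - o).val < (x - o).val) := by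
      intro s hs
      rw [mem_filter] at hs ⊢
      refine ⟨hs.1, hs.2.1, ?_⟩
      by_contra hge
      push Not at hge
      have hne' : (x - o).val ≠ (s - o).val := fun h => hx (rot_injective o h ▸ hs.2.1)
      exact absurd hs.2.2 (not_lt.2 (hno s hs.2.1 (lt_of_le_of_ne hge hne')))
    have h1 := card_le_card hsub
    have h2 := cnt_mono o S hlt.le
    omega
  -- an `S`-walk from `k₁` to `o` leaves the interval `(x, x')` through a crossing edge
  obtain ⟨W, hW⟩ := hS k₁ hk₁S
  let A : Set (Fin n) := {v | (x - o).val < (v - o).val ∧ (v - o).val < (x' - o).val}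
  have hk₁A : k₁ ∈ A := ⟨hk₁a, hk₁b⟩
  have hoA : o ∉ A := fun h => by
    have h' : (x - o).val < (o - o).val := h.1
    rw [rot_self] at h'
    exact Nat.not_lt_zero _ h'
  obtain ⟨d, hd, hd1, hd2⟩ := W.reverse.exists_boundary_dart A hk₁A hoA
  have hvS : d.snd ∈ S := by
    refine hW _ ?_
    have := W.reverse.dart_snd_mem_support_of_mem_darts hd
    rwa [SimpleGraph.Walk.support_reverse, List.mem_reverse] at this
  have hvx : (d.snd - o).val ≠ (x - o).val := fun h => hx (rot_injective o h ▸ hvS)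
  have hvx' : (d.snd - o).val ≠ (x' - o).val := fun h => hx' (rot_injective o h ▸ hvS)
  have hu1 : (x - o).val < (d.fst - o).val := hd1.1
  have hu2 : (d.fst - o).val < (x' - o).val := hd1.2
  have hd2' : ¬ ((x - o).val < (d.snd - o).val ∧ (d.snd - o).val < (x' - o).val) := hd2
  rcases not_and_or.1 hd2' with hle | hle
  · exact hnc d.snd d.fst x x' d.adj.symm hadj (lt_of_le_of_ne (not_lt.1 hle) hvx) hu1 hu2
  · exact hnc x x' d.fst d.snd hadj d.adj hu1 hu2 (lt_of_le_of_ne (not_lt.1 hle) (Ne.symm hvx'))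

/-- KEY LEMMA: for `S` connected from `o` inside `H[S]` (`o ∈ S`) and a non-crossing `H`, two ADJACENT vertices outside `S` lie in the
same gap of `S`. [folklore: discrete Jordan curve theorem on a cycle] -/
theorem cnt_eq_of_adj {H : SimpleGraph (Fin n)} {o : Fin n}
    (hnc : ∀ p q r s : Fin n, H.Adj p q → H.Adj r s → (p - o).val < (r - o).val → (r - o).val < (q - o).val → (q - o).val < (s - o).val → False)
    {S : Set (Fin n)} (hS : ∀ s ∈ S, ∃ W : H.Walk o s, ∀ v ∈ W.support, v ∈ S)
    {x x' : Fin n} (hx : x ∉ S) (hx' : x' ∉ S) (hadj : H.Adj x x') : (Finset.univ.filter (fun s => s ∈ S ∧ (s - o).val < (x - o).val)).card = (Finset.univ.filter (fun s => s ∈ S ∧ (s - o).val < (x' - o).val)).card := by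
  rcases lt_trichotomy ((x - o).val) ((x' - o).val) with hlt | heq | hgt
  · exact cnt_eq_of_adj_lt hnc hS hx hx' hadj hlt
  · rw [heq]
  · exact (cnt_eq_of_adj_lt hnc hS hx' hx hadj.symm hgt).symm

/-- A walk avoiding `S` stays in one gap of `S`. [folklore] -/
theorem cnt_eq_of_walk {H : SimpleGraph (Fin n)} {o : Fin n}
    (hnc : ∀ p q r s : Fin n, H.Adj p q → H.Adj r s → (p - o).val < (r - o).val → (r - o).val < (q - o).val → (q - o).val < (s - o).val → False)
    {S : Set (Fin n)} (hS : ∀ s ∈ S, ∃ W : H.Walk o s, ∀ v ∈ W.support, v ∈ S)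
    {p q : Fin n} (P : H.Walk p q) (hP : ∀ v ∈ P.support, v ∉ S) : (Finset.univ.filter (fun s => s ∈ S ∧ (s - o).val < (p - o).val)).card = (Finset.univ.filter (fun s => s ∈ S ∧ (s - o).val < (q - o).val)).card := by
  induction P with
  | nil => rfl
  | @cons u v z hadj P ih =>
    have hu : u ∉ S := hP u (SimpleGraph.Walk.start_mem_support _)
    have hv : v ∉ S := hP v (by simp)
    rw [cnt_eq_of_adj hnc hS hu hv hadj]
    exact ih fun t ht => hP t (by simp [ht])

/-! ### Connected sets in walk form -/

/-- The closure form of "`K` is `H`-connected from `a`" (as in `Consts.not_doubleClash_of_unlinked`) gives walks inside `K`.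
[folklore] -/
theorem walks_of_closure {H : SimpleGraph (Fin n)} {K : Set (Fin n)} {a : Fin n} (haK : a ∈ K)
    (hcl : ∀ T : Set (Fin n), a ∈ T → (∀ u x, u ∈ T → H.Adj u x → x ∈ K → x ∈ T) → K ⊆ T) :
    ∀ s ∈ K, ∃ W : H.Walk a s, ∀ v ∈ W.support, v ∈ K := by
  intro s hs
  refine hcl {v | ∃ W : H.Walk a v, ∀ z ∈ W.support, z ∈ K} ⟨SimpleGraph.Walk.nil, ?_⟩ ?_ hs
  · intro z hz
    rw [SimpleGraph.Walk.support_nil, List.mem_singleton] at hz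
    exact hz ▸ haK
  · rintro u x ⟨W, hW⟩ hux hxK
    refine ⟨W.concat hux, fun z hz => ?_⟩
    rw [SimpleGraph.Walk.support_concat, List.mem_append, List.mem_singleton] at hz
    rcases hz with hz | rfl
    · exact hW z hz
    · exact hxK

/-- Extending a set connected from `a` by a walk starting at a neighbour of the set keeps it connected from `a`. [folklore] -/
theorem walks_extend {H : SimpleGraph (Fin n)} {K : Set (Fin n)} {a k y t : Fin n}
    (hKw : ∀ s ∈ K, ∃ W : H.Walk a s, ∀ v ∈ W.support, v ∈ K) (hk : k ∈ K) (hky : H.Adj k y) (Q : H.Walk y t) :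
    ∀ s ∈ K ∪ {v | v ∈ Q.support}, ∃ W : H.Walk a s, ∀ v ∈ W.support, v ∈ K ∪ {v | v ∈ Q.support} := by
  intro s hs
  rcases hs with hsK | hsQ
  · obtain ⟨W, hW⟩ := hKw s hsK
    exact ⟨W, fun v hv => Or.inl (hW v hv)⟩
  · have hsQ : s ∈ Q.support := hsQ
    obtain ⟨W, hW⟩ := hKw k hk
    refine ⟨(W.concat hky).append (Q.takeUntil s hsQ), fun v hv => ?_⟩
    rw [SimpleGraph.Walk.support_append, List.mem_append] at hv
    rcases hv with hv | hv
    · rw [SimpleGraph.Walk.support_concat, List.mem_append, List.mem_singleton] at hv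
      rcases hv with hv | rfl
      · exact Or.inl (hW v hv)
      · exact Or.inr (Q.start_mem_support)
    · exact Or.inr (Q.support_takeUntil_subset_support hsQ (List.mem_of_mem_tail hv))

/-! ### No double linkage in a non-crossing graph -/

/-- **In a non-crossing (outerplanar) graph no `H`-connected `K ∋ a` is doubly linked to `{b, c}`**: the hypothesis `hK` of
`Consts.clusterSquare_le_sq_of_unlinked` holds for every `a, b, c`.  [folklore: Jordan curve theorem on the outer cycle; cf. the
planar common-face remark of Gladkov2024, Thm. 6.1] -/
theorem unlinked (H : SimpleGraph (Fin n))
    (hnc : ∀ p q r s : Fin n, H.Adj p q → H.Adj r s → p < r → r < q → q < s → False) (a b c : Fin n) :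
    ∀ (K : Set (Fin n)) (y y' : Fin n), a ∈ K → b ∉ K → c ∉ K →
      (∀ T : Set (Fin n), a ∈ T → (∀ u x, u ∈ T → H.Adj u x → x ∈ K → x ∈ T) → K ⊆ T) →
      y ∉ K → y' ∉ K → (∃ k, k ∈ K ∧ H.Adj k y) → (∃ k, k ∈ K ∧ H.Adj k y') →
      y ≠ a → y ≠ b → y ≠ c → y' ≠ a → y' ≠ b → y' ≠ c → y ≠ y' →
      (∀ (P₁ : H.Walk y b) (P₂ : H.Walk y' c), (∀ x ∈ P₁.support, x ∉ K) → (∀ x ∈ P₂.support, x ∉ K) →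
          ∃ x, x ∈ P₁.support ∧ x ∈ P₂.support) ∨
      (∀ (Q₁ : H.Walk y c) (Q₂ : H.Walk y' b), (∀ x ∈ Q₁.support, x ∉ K) → (∀ x ∈ Q₂.support, x ∉ K) →
          ∃ x, x ∈ Q₁.support ∧ x ∈ Q₂.support) := by
  intro K y y' haK hbK hcK hcl hyK hy'K hky hk'y' _ hyb hyc _ hy'b hy'c hyy'
  obtain ⟨k, hkK, hky⟩ := hky
  obtain ⟨k', hk'K, hk'y'⟩ := hk'y'
  by_contra h
  push Not at h
  obtain ⟨⟨P₁, P₂, hP₁, hP₂, hPd⟩, ⟨Q₁, Q₂, hQ₁, hQ₂, hQd⟩⟩ := h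
  have hncρ : ∀ p q r s : Fin n, H.Adj p q → H.Adj r s →
      (p - a).val < (r - a).val → (r - a).val < (q - a).val → (q - a).val < (s - a).val → False :=
    fun p q r s hpq hrs => noncross_rot hnc a hpq hrs
  have hKw := walks_of_closure haK hcl
  -- memberships in the four supports
  have hyP₁ : y ∈ P₁.support := P₁.start_mem_support
  have hbP₁ : b ∈ P₁.support := P₁.end_mem_support
  have hy'P₂ : y' ∈ P₂.support := P₂.start_mem_support
  have hcP₂ : c ∈ P₂.support := P₂.end_mem_support
  have hyQ₁ : y ∈ Q₁.support := Q₁.start_mem_support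
  have hcQ₁ : c ∈ Q₁.support := Q₁.end_mem_support
  have hy'Q₂ : y' ∈ Q₂.support := Q₂.start_mem_support
  have hbQ₂ : b ∈ Q₂.support := Q₂.end_mem_support
  have hbc : b ≠ c := fun h => hPd b hbP₁ (h ▸ hcP₂)
  -- distinct positions
  have rbc : (b - a).val ≠ (c - a).val := fun h => hbc (rot_injective a h)
  have ryb : (y - a).val ≠ (b - a).val := fun h => hyb (rot_injective a h)
  have ryc : (y - a).val ≠ (c - a).val := fun h => hyc (rot_injective a h)
  have ry'b : (y' - a).val ≠ (b - a).val := fun h => hy'b (rot_injective a h)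
  have ry'c : (y' - a).val ≠ (c - a).val := fun h => hy'c (rot_injective a h)
  have ryy' : (y - a).val ≠ (y' - a).val := fun h => hyy' (rot_injective a h)
  -- the sets `K ∪ {y}` and `K ∪ {y'}`
  have hSy := walks_extend hKw hkK hky (SimpleGraph.Walk.nil : H.Walk y y)
  have hSy' := walks_extend hKw hk'K hk'y' (SimpleGraph.Walk.nil : H.Walk y' y')
  have memy : ∀ v, v ∈ K ∪ {v | v ∈ (SimpleGraph.Walk.nil : H.Walk y y).support} ↔ v ∈ K ∨ v = y := fun v => by
    simp only [Set.mem_union, Set.mem_setOf_eq, SimpleGraph.Walk.support_nil, List.mem_singleton]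
  have memy' : ∀ v, v ∈ K ∪ {v | v ∈ (SimpleGraph.Walk.nil : H.Walk y' y').support} ↔ v ∈ K ∨ v = y' := fun v => by
    simp only [Set.mem_union, Set.mem_setOf_eq, SimpleGraph.Walk.support_nil, List.mem_singleton]
  -- F2: w.r.t. `K ∪ {y}`, the walks `P₂ : y' → c` and `Q₂ : y' → b` avoid it
  have F2c := cnt_eq_of_walk hncρ hSy P₂ fun v hv hvS => by
    rcases (memy v).1 hvS with hvK | rfl
    · exact hP₂ v hv hvK
    · exact hPd _ hyP₁ hv
  have F2b := cnt_eq_of_walk hncρ hSy Q₂ fun v hv hvS => by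
    rcases (memy v).1 hvS with hvK | rfl
    · exact hQ₂ v hv hvK
    · exact hQd _ hyQ₁ hv
  -- F3: w.r.t. `K ∪ {y'}`, the walks `P₁ : y → b` and `Q₁ : y → c` avoid it
  have F3b := cnt_eq_of_walk hncρ hSy' P₁ fun v hv hvS => by
    rcases (memy' v).1 hvS with hvK | rfl
    · exact hP₁ v hv hvK
    · exact hPd _ hv hy'P₂
  have F3c := cnt_eq_of_walk hncρ hSy' Q₁ fun v hv hvS => by
    rcases (memy' v).1 hvS with hvK | rfl
    · exact hQ₁ v hv hvK
    · exact hQd _ hv hy'Q₂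
  have hyS : y ∈ K ∪ {v | v ∈ (SimpleGraph.Walk.nil : H.Walk y y).support} := (memy y).2 (Or.inr rfl)
  have hy'S : y' ∈ K ∪ {v | v ∈ (SimpleGraph.Walk.nil : H.Walk y' y').support} := (memy' y').2 (Or.inr rfl)
  obtain ⟨G1, G2⟩ := not_between_of_cnt_eq' a _ F2c hyS
  obtain ⟨G3, G4⟩ := not_between_of_cnt_eq' a _ F2b hyS
  obtain ⟨G5, G6⟩ := not_between_of_cnt_eq' a _ F3b hy'S
  obtain ⟨G7, G8⟩ := not_between_of_cnt_eq' a _ F3c hy'S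
  -- so `y, y'` are the extreme points of `{y, y', b, c}`; the interleaved linkage crosses the other one
  rcases Nat.lt_or_gt_of_ne ryy' with hyy | hyy
  · -- `y` is the minimum, `y'` the maximum
    rcases Nat.lt_or_gt_of_ne rbc with hbc' | hbc'
    · -- y < b < c < y' : `Q₂ : y' → b` avoids `K ∪ supp Q₁ ∋ c`
      have hS := walks_extend hKw hkK hky Q₁
      have F := cnt_eq_of_walk hncρ hS Q₂ fun v hv hvS => by
        rcases hvS with hvK | hvQ
        · exact hQ₂ v hv hvK
        · exact hQd v hvQ hv
      exact not_between_of_cnt_eq a _ F.symm (Or.inr hcQ₁) hbc' (by omega)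
    · -- y < c < b < y' : `P₂ : y' → c` avoids `K ∪ supp P₁ ∋ b`
      have hS := walks_extend hKw hkK hky P₁
      have F := cnt_eq_of_walk hncρ hS P₂ fun v hv hvS => by
        rcases hvS with hvK | hvP
        · exact hP₂ v hv hvK
        · exact hPd v hvP hv
      exact not_between_of_cnt_eq a _ F.symm (Or.inr hbP₁) hbc' (by omega)
  · -- `y'` is the minimum, `y` the maximum
    rcases Nat.lt_or_gt_of_ne rbc with hbc' | hbc'
    · -- y' < b < c < y : `P₁ : y → b` avoids `K ∪ supp P₂ ∋ c`
      have hS := walks_extend hKw hk'K hk'y' P₂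
      have F := cnt_eq_of_walk hncρ hS P₁ fun v hv hvS => by
        rcases hvS with hvK | hvP
        · exact hP₁ v hv hvK
        · exact hPd v hv hvP
      exact not_between_of_cnt_eq a _ F.symm (Or.inr hcP₂) hbc' (by omega)
    · -- y' < c < b < y : `Q₁ : y → c` avoids `K ∪ supp Q₂ ∋ b`
      have hS := walks_extend hKw hk'K hk'y' Q₂
      have F := cnt_eq_of_walk hncρ hS Q₁ fun v hv hvS => by
        rcases hvS with hvK | hvQ
        · exact hQ₁ v hv hvK
        · exact hQd v hv hvQ
      exact not_between_of_cnt_eq a _ F.symm (Or.inr hbQ₂) hbc' (by omega)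

end NonCrossing

/-! ### CSQ, DUU, TS on outerplanar graphs -/

section Fin

variable {n : ℕ} (w : Sym2 (Fin n) → unitInterval) (a b c : Fin n) (H : SimpleGraph (Fin n))

/-- **CSQ on every weighted outerplanar graph.**  If the positive pairs of `w` lie in a graph `H` on `Fin n` that is non-crossing for
the cyclic order `0, …, n-1` (no edges `{p,q}`, `{r,s}` with `p < r < q < s`), then for all `a, b, c`:
`clusterSquare w a b c ≤ μ(b ↮ c)²`. [cite: Gladkov2024, Thm. 4.3, Def. 4.2, Lemma 3.1, Thm. 5.2] -/
theorem clusterSquare_le_sq_of_nonCrossing (hH : ∀ u v, u ≠ v → (0 : ℝ) < w s(u, v) → H.Adj u v)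
    (hnc : ∀ p q r s : Fin n, H.Adj p q → H.Adj r s → p < r → r < q → q < s → False) :
    clusterSquare w a b c ≤ (prodBernoulli w).real (openConn b c)ᶜ ^ 2 :=
  clusterSquare_le_sq_of_unlinked w a b c H hH (NonCrossing.unlinked H hnc a b c)

/-- **DUU (rooted split inequality) on every weighted outerplanar graph**, every root:
`μ(a↮b, a↮c, b↮c)² ≤ μ(a↮b, a↮c) · μ(b↮c)²`. [cite: Gladkov2024, Thm. 5.2 and Thm. 4.3] -/
theorem sq_real_split_le_of_nonCrossing (hH : ∀ u v, u ≠ v → (0 : ℝ) < w s(u, v) → H.Adj u v)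
    (hnc : ∀ p q r s : Fin n, H.Adj p q → H.Adj r s → p < r → r < q → q < s → False) :
    (prodBernoulli w).real ((openConn a b)ᶜ ∩ (openConn a c)ᶜ ∩ (openConn b c)ᶜ) ^ 2 ≤
      (prodBernoulli w).real ((openConn a b)ᶜ ∩ (openConn a c)ᶜ) * (prodBernoulli w).real (openConn b c)ᶜ ^ 2 :=
  sq_real_split_le_of_unlinked w a b c H hH (NonCrossing.unlinked H hnc a b c)

/-- **TS (triple-split inequality) on every weighted outerplanar graph**, every triple of terminals:
`μ(a↮b, a↮c, b↮c)² ≤ μ(a↮b) · μ(a↮c) · μ(b↮c)`. [cite: Gladkov2024, Thm. 5.2, Cor. 5.3 (pattern) and Thm. 4.3] -/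
theorem tripleSplit_of_nonCrossing (hH : ∀ u v, u ≠ v → (0 : ℝ) < w s(u, v) → H.Adj u v)
    (hnc : ∀ p q r s : Fin n, H.Adj p q → H.Adj r s → p < r → r < q → q < s → False) :
    (prodBernoulli w).real ((openConn a b)ᶜ ∩ (openConn a c)ᶜ ∩ (openConn b c)ᶜ) ^ 2 ≤
      (prodBernoulli w).real (openConn a b)ᶜ * (prodBernoulli w).real (openConn a c)ᶜ *
        (prodBernoulli w).real (openConn b c)ᶜ :=
  tripleSplit_of_unlinked w a b c H hH (NonCrossing.unlinked H hnc a b c)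

end Fin

end Consts

end Summit.CriticalPhenomena.PercolationContinuityZ3.Theorems
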